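import Literature.NumberTheory.DiophantineGeometry.CatalanObstruction
import Literature.NumberTheory.DiophantineGeometry.CatalanMinusPower
import Mathlib.NumberTheory.NumberField.Cyclotomic.PID
import Mathlib.NumberTheory.NumberField.Cyclotomic.Three
import HarnessLib

/-!
# Catalan's equation with an exponent `3`: Nagell's theorem (Theorem IV for the prime `3`)

**Nagell's theorem** (T. Nagell 1921; [BiluBugeaudMignotte2014, Theorem 6.10], proof of
K. Inkeri): *for a prime `q ≥ 5` the equation `x³ - y^q = 1` has no solution in non-zero integers.*
This is the case `p = 3` (and, by the symmetry `(x, y, p, q) ↦ (-y, -x, q, p)`, the case `q = 3`)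
of [Schoof2009, Theorem IV] ("`p` or `q ≤ 41`"), which Schoof obtains from Theorem 8.3 and
`h⁻(ℚ(ζ₃)) = 1`; Mihăilescu's Theorems II and III are stated for `p, q ≥ 5` (resp. `≥ 7`) and need it.

We follow Inkeri's proof as printed in [BiluBugeaudMignotte2014, §6.3]. In `K = ℚ(ζ₃)` (class
number one, units `±ζ₃^k`: Mathlib's `IsCyclotomicExtension.Rat.three_pid`,
`IsCyclotomicExtension.Rat.Three.Units.mem`), the ideal equation `(x - ζ₃) = 𝔭 𝔞^q`
([Schoof2009, Propositions 7.2–7.3], `Catalan.span_sub_zeta_pow_eq`) gives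
`x - ζ₃ = (ζ₃ - ζ̄₃) α^q` with `α ∈ ℤ[ζ₃]` (all units are `q`-th powers), hence
`α^q + ᾱ^q = -1`. [BiluBugeaudMignotte2014, Lemma 6.9]: then `α + ᾱ` divides `-1`, is `±1`,
in fact `-1` (`q ∤ 2`), and the identity `(1 + α)^q - α^q = 1` forces `α(1 + α)` to be a unit
(`Catalan.Nagell.isUnit_mul_one_add`: `(1+X)^q - X^q - 1 ≡ q X(1+X) (mod q X²(1+X)²)`), so
`α` is a unit and `x² + x + 1 = N(x - ζ₃) = 3`, i.e. `x ∈ {1, -2}`, neither of which gives a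
solution.

* `Catalan.Nagell.isUnit_mul_one_add` — the algebraic heart of [BiluBugeaudMignotte2014, Lemma 6.9];
* `Catalan.Nagell.cube_sub_pow_ne_one` — **Nagell's theorem**: `x³ - y^q ≠ 1` (`q ≥ 5` prime,
  `x, y ≠ 0`); `Catalan.Nagell.pow_sub_cube_ne_one` — the mirror case `x^q - y³ ≠ 1`;
* `Catalan.Nagell.five_le` — for odd primes `p, q` and a non-zero solution of `x^p - y^q = 1`,
  `5 ≤ p` and `5 ≤ q` ([Schoof2009, Theorem IV] for the prime `3`).

Everything is proved; no definitions, no named facts.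

## References

* Yu. F. Bilu, Y. Bugeaud, M. Mignotte, *The Problem of Catalan*, Springer 2014
  [BiluBugeaudMignotte2014], §6.3, Lemma 6.9 and Theorem 6.10 — held (galaxy),
  `lit read book:bilund-problem-catalan` (chunks 54–55).
* T. Nagell, *Des équations indéterminées `x² + x + 1 = yⁿ` et `x² + x + 1 = 3yⁿ`*, Norsk Mat.
  Forenings Skrifter (1) **2** (1921), 12–14.
* R. Schoof, *Catalan's Conjecture*, Universitext, Springer 2009 [Schoof2009], Theorem IV (p. 4),
  Chapter 8.
-/

namespace Literature.NumberTheory.DiophantineGeometry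

namespace Catalan.Nagell

open NumberField Finset
open Literature.NumberTheory.NumberFields.Stickelberger
open scoped Pointwise

/-! ### The algebraic lemma: `(1 + α)^q - α^q = 1` forces `α(1 + α)` to be a unit -/

/-- The middle binomial terms: for `2 ≤ k ≤ q - 2`, `q (αy)² ∣ binom(q, k) y^k α^{q-k}`. [folklore] -/
theorem dvd_middle_term {R : Type*} [CommRing R] {q : ℕ} (hq : q.Prime) (y α : R) {k : ℕ}
    (hk2 : 2 ≤ k) (hkq : k + 2 ≤ q) :
    (q : R) * (α * y) ^ 2 ∣ y ^ k * (-α) ^ (q - k) * (q.choose k : R) := by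
  obtain ⟨c, hc⟩ := hq.dvd_choose_self (k := k) (by omega) (by omega)
  refine ⟨y ^ (k - 2) * (-α) ^ (q - k - 2) * c, ?_⟩
  rw [hc, Nat.cast_mul]
  have e1 : y ^ k = y ^ 2 * y ^ (k - 2) := by rw [← pow_add]; congr 1; omega
  have e2 : (-α) ^ (q - k) = (-α) ^ 2 * (-α) ^ (q - k - 2) := by rw [← pow_add]; congr 1; omega
  rw [e1, e2, neg_sq]
  ring

/-- `α (1 + α) ∣ (1 + α)^{n+1} - α^{n+1} - 1` for even `n ≥ 2` (the residue of
`(1+α)^{q-2} - α^{q-2}` modulo `α(1+α)` is `1`). [cite: BiluBugeaudMignotte2014, Lemma 6.9 (proof)] -/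
theorem dvd_pow_sub_pow_sub_one {R : Type*} [CommRing R] (α : R) {n : ℕ} (hn : Even n) (hn2 : 2 ≤ n) :
    α * (1 + α) ∣ (1 + α) ^ (n + 1) - α ^ (n + 1) - 1 := by
  set y := 1 + α with hy
  -- `y^{n+1} - α^{n+1} = ∑_{i ≤ n} y^i α^{n-i}` since `y - α = 1`
  have hG : ∑ i ∈ range (n + 1), y ^ i * α ^ (n - i) = y ^ (n + 1) - α ^ (n + 1) := by
    have := geom_sum₂_mul y α (n + 1)
    rw [show y - α = 1 by rw [hy]; ring, mul_one] at this
    simpa using this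
  rw [← hG]
  -- split off `i = 0` and `i = n`
  obtain ⟨m, rfl⟩ : ∃ m, n = m + 2 := ⟨n - 2, by omega⟩
  rw [sum_range_succ, sum_range_succ']
  simp only [Nat.sub_self, pow_zero, mul_one, one_mul, Nat.sub_zero]
  -- the middle terms are multiples of `α y`
  have hmid : α * y ∣ ∑ i ∈ range (m + 1), y ^ (i + 1) * α ^ (m + 2 - (i + 1)) := by
    refine dvd_sum fun i hi => ?_
    rw [mem_range] at hi
    refine ⟨y ^ i * α ^ (m - i), ?_⟩
    rw [show m + 2 - (i + 1) = (m - i) + 1 by omega, pow_succ, pow_succ]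
    ring
  -- `α y ∣ α^{m+2} + y^{m+2} - 1`
  have hends : α * y ∣ α ^ (m + 2) + y ^ (m + 2) - 1 := by
    have h1 : y ∣ α ^ (m + 1) + 1 := by
      have := Odd.add_dvd_pow_add_pow α 1 (n := m + 1) (by
        rcases hn with ⟨k, hk⟩; exact ⟨k - 1, by omega⟩)
      rwa [one_pow, show α + 1 = y by rw [hy]; ring] at this
    have h2 : y ∣ ∑ i ∈ range (m + 2), y ^ i - 1 := by
      rw [geom_sum_succ, add_sub_cancel_right]
      exact dvd_mul_right _ _
    have h3 : α ^ (m + 2) + y ^ (m + 2) - 1 =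
        α * ((α ^ (m + 1) + 1) + (∑ i ∈ range (m + 2), y ^ i - 1)) := by
      have hgs := geom_sum_mul y (m + 2)
      rw [show y - 1 = α by rw [hy]; ring] at hgs
      linear_combination -hgs
    rw [h3]
    exact mul_dvd_mul_left α (dvd_add h1 h2)
  have e : ∑ i ∈ range (m + 1), y ^ (i + 1) * α ^ (m + 2 - (i + 1)) + α ^ (m + 2) + y ^ (m + 2) - 1 =
      ∑ i ∈ range (m + 1), y ^ (i + 1) * α ^ (m + 2 - (i + 1)) + (α ^ (m + 2) + y ^ (m + 2) - 1) := by
    ring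
  rw [e]
  exact dvd_add hmid hends

/-- **The heart of [BiluBugeaudMignotte2014, Lemma 6.9]**: in a domain of characteristic `0`, if
`q ≥ 5` is prime, `α ≠ 0, -1` and `(1 + α)^q - α^q = 1`, then `α(1 + α)` is a unit. (From
`1 = ((1+α) - α)^q`, the identity `(1+α)^q - α^q - 1 = q u (α^{q-2} - (1+α)^{q-2}) + q u² m` with
`u = α(1+α)`, and `α^{q-2} - (1+α)^{q-2} ≡ -1 (mod u)`, one gets `q u = q u² (…)`.)
[cite: BiluBugeaudMignotte2014, Lemma 6.9] -/
theorem isUnit_mul_one_add {R : Type*} [CommRing R] [IsDomain R] [CharZero R] {q : ℕ} (hq : q.Prime)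
    (hq5 : 5 ≤ q) {α : R} (h0 : α ≠ 0) (h1 : 1 + α ≠ 0) (h : (1 + α) ^ q - α ^ q = 1) :
    IsUnit (α * (1 + α)) := by
  obtain ⟨n, rfl⟩ : ∃ n, q = n + 3 := ⟨q - 3, by omega⟩
  set y := 1 + α with hy
  set u := α * y with hu
  have hodd : Odd (n + 3) := hq.odd_of_ne_two (by omega)
  have hevn : Even n := by rcases hodd with ⟨k, hk⟩; exact ⟨k - 1, by omega⟩
  have hu0 : u ≠ 0 := mul_ne_zero h0 h1
  have hq0 : ((n + 3 : ℕ) : R) ≠ 0 := Nat.cast_ne_zero.mpr (by omega)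
  -- the binomial expansion of `1 = (y - α)^{n+3}`
  set f : ℕ → R := fun k => y ^ k * (-α) ^ (n + 3 - k) * ((n + 3).choose k : R) with hf
  have hexp : (1 : R) = ∑ k ∈ range (n + 3 + 1), f k := by
    have : (y + -α) ^ (n + 3) = 1 := by rw [hy]; ring_nf
    rw [← this, add_pow]
  -- split off `k = n+3, 0, n+2, 1`
  have hsplit : ∑ k ∈ range (n + 3 + 1), f k =
      ∑ i ∈ range n, f (i + 2) + f 1 + f (n + 2) + f 0 + f (n + 3) := by
    rw [sum_range_succ, sum_range_succ', sum_range_succ, sum_range_succ']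
  have hf0 : f 0 = -α ^ (n + 3) := by
    simp only [hf, pow_zero, one_mul, Nat.sub_zero, Nat.choose_zero_right, Nat.cast_one, mul_one]
    rw [hodd.neg_pow]
  have hftop : f (n + 3) = y ^ (n + 3) := by
    simp only [hf, Nat.sub_self, pow_zero, mul_one, Nat.choose_self, Nat.cast_one]
  have hf1 : f 1 = (n + 3 : ℕ) * u * α ^ (n + 1) := by
    simp only [hf, pow_one, Nat.choose_one_right, show n + 3 - 1 = n + 2 by omega]
    rw [Even.neg_pow (by rcases hevn with ⟨k, hk⟩; exact ⟨k + 1, by omega⟩), hu,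
      show n + 2 = (n + 1) + 1 by omega, pow_succ]
    ring
  have hftop' : f (n + 2) = -((n + 3 : ℕ) * u * y ^ (n + 1)) := by
    have hc : (n + 3).choose (n + 2) = n + 3 := by
      have := Nat.choose_symm (show 1 ≤ n + 3 by omega)
      rw [show n + 3 - 1 = n + 2 by omega, Nat.choose_one_right] at this
      exact this
    simp only [hf, show n + 3 - (n + 2) = 1 by omega, pow_one, hc]
    rw [hu, show n + 2 = (n + 1) + 1 by omega, pow_succ]
    ring
  -- the middle sum is a multiple of `q u²`
  have hmid : ((n + 3 : ℕ) : R) * u ^ 2 ∣ ∑ i ∈ range n, f (i + 2) := by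
    refine dvd_sum fun i hi => ?_
    rw [mem_range] at hi
    exact dvd_middle_term hq y α (k := i + 2) (by omega) (by omega)
  obtain ⟨m, hm⟩ := hmid
  -- `(**)`: `q u² m + q u (α^{n+1} - y^{n+1}) = 0`
  have hstar : ((n + 3 : ℕ) : R) * u ^ 2 * m + (n + 3 : ℕ) * u * (α ^ (n + 1) - y ^ (n + 1)) = 0 := by
    have := hexp
    rw [hsplit, hm, hf0, hftop, hf1, hftop'] at this
    linear_combination -this - h
  -- `y^{n+1} - α^{n+1} = 1 + u r`
  obtain ⟨r, hr⟩ := dvd_pow_sub_pow_sub_one α hevn (by omega)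
  -- hence `q u = q u² (m - r)` and `1 = u (m - r)`
  have hfinal : ((n + 3 : ℕ) : R) * u * (1 - u * (m - r)) = 0 := by
    have e : α ^ (n + 1) - y ^ (n + 1) = -(1 + u * r) := by linear_combination -hr
    rw [e] at hstar
    linear_combination -hstar
  rcases mul_eq_zero.mp hfinal with h' | h'
  · exact absurd h' (mul_ne_zero hq0 hu0)
  · exact isUnit_iff_exists_inv.mpr ⟨m - r, by linear_combination -h'⟩

/-! ### The third cyclotomic field -/

section Cyclotomic

variable {K : Type*} [Field K] [NumberField K] [hK : IsCyclotomicExtension {3} ℚ K] {ζ : K}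
  (hζ : IsPrimitiveRoot ζ 3)

local notation3 "σ" => gal 3 K (-1)

omit [NumberField K] hK in
include hζ in
/-- `ζ₃² + ζ₃ + 1 = 0` in `𝓞 K`. [folklore] -/
theorem toInteger_sq_add : hζ.toInteger ^ 2 + hζ.toInteger + 1 = 0 := by
  have h3 : hζ.toInteger ^ 3 = 1 := hζ.toInteger_isPrimitiveRoot.pow_eq_one
  have hne : hζ.toInteger ≠ 1 := hζ.toInteger_isPrimitiveRoot.ne_one (by norm_num)
  have : (hζ.toInteger - 1) * (hζ.toInteger ^ 2 + hζ.toInteger + 1) = 0 := by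
    linear_combination h3
  rcases mul_eq_zero.mp this with h | h
  · exact absurd (sub_eq_zero.mp h) hne
  · exact h

include hζ in
/-- Complex conjugation: `σ ζ₃ = ζ₃²`. [folklore] -/
theorem smul_toInteger : σ • hζ.toInteger = hζ.toInteger ^ 2 := by
  have hv : ((-1 : (ZMod 3)ˣ) : ZMod 3).val = 2 := by decide
  rw [Minus.gal_smul_toInteger hζ, hv]

/-- `σ² = 1`. [folklore] -/
theorem smul_smul_eq (t : 𝓞 K) : σ • σ • t = t := by
  rw [smul_smul, ← gal_mul, neg_mul_neg, one_mul, gal_one, one_smul]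

omit [NumberField K] hK in
include hζ in
/-- `ζ₃² ≠ ζ₃`, i.e. `ζ₃ - ζ̄₃ ≠ 0`. [folklore] -/
theorem toInteger_sub_sq_ne_zero : hζ.toInteger - hζ.toInteger ^ 2 ≠ 0 := by
  intro h
  have hne : hζ.toInteger ≠ 1 := hζ.toInteger_isPrimitiveRoot.ne_one (by norm_num)
  have h0 : hζ.toInteger ≠ 0 := hζ.toInteger_isPrimitiveRoot.ne_zero (by norm_num)
  have : hζ.toInteger * (1 - hζ.toInteger) = 0 := by linear_combination h
  rcases mul_eq_zero.mp this with h' | h'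
  · exact h0 h'
  · exact hne (sub_eq_zero.mp h').symm

include hζ in
/-- **A `σ`-invariant unit of `ℤ[ζ₃]` is `±1`** (the units are `±ζ₃^k`). [folklore] -/
theorem eq_one_or_eq_neg_one_of_isUnit {t : 𝓞 K} (ht : IsUnit t) (hσ : σ • t = t) :
    t = 1 ∨ t = -1 := by
  obtain ⟨u, rfl⟩ := ht
  have hmem := IsCyclotomicExtension.Rat.Three.Units.mem hζ u
  have hησ : σ • (hζ.toInteger) ≠ hζ.toInteger := by
    rw [smul_toInteger hζ]
    exact fun h => toInteger_sub_sq_ne_zero hζ (by rw [h, sub_self])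
  have hη2 : σ • (hζ.toInteger ^ 2) ≠ hζ.toInteger ^ 2 := by
    rw [smul_pow', smul_toInteger hζ, ← pow_mul]
    intro h
    have h3 : hζ.toInteger ^ 3 = 1 := hζ.toInteger_isPrimitiveRoot.pow_eq_one
    have : hζ.toInteger ^ (2 * 2) = hζ.toInteger := by
      rw [show 2 * 2 = 3 + 1 by norm_num, pow_add, h3, one_mul, pow_one]
    rw [this] at h
    exact toInteger_sub_sq_ne_zero hζ (sub_eq_zero.mpr h)
  simp only [List.mem_cons, List.not_mem_nil, or_false] at hmem
  rcases hmem with h | h | h | h | h | h <;> rw [h] at hσ ⊢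
  · left; rfl
  · right; rfl
  · exact absurd hσ hησ
  · rw [Units.val_neg, smul_neg, neg_inj] at hσ
    exact absurd hσ hησ
  · rw [Units.val_pow_eq_pow_val] at hσ
    exact absurd hσ hη2
  · rw [Units.val_neg, smul_neg, neg_inj, Units.val_pow_eq_pow_val] at hσ
    exact absurd hσ hη2

include hζ in
/-- Every unit of `ℤ[ζ₃]` is a `q`-th power for `q` prime to `6`. [cite: BiluBugeaudMignotte2014, Theorem 6.10 (proof)] -/
theorem exists_unit_eq_pow (u : (𝓞 K)ˣ) {q : ℕ} (hq : q.Coprime 6) : ∃ v : (𝓞 K)ˣ, u = v ^ q := by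
  haveI : Fact (Nat.Prime 3) := ⟨Nat.prime_three⟩
  have h6 : u ^ (2 * 3) = 1 := by
    have hmem := IsCyclotomicExtension.Rat.Three.Units.mem hζ u
    have h3 : ((IsPrimitiveRoot.isUnit hζ.toInteger_isPrimitiveRoot (by decide)).unit) ^ 3 = 1 := by
      apply Units.ext
      rw [Units.val_pow_eq_pow_val, IsUnit.unit_spec, Units.val_one]
      exact hζ.toInteger_isPrimitiveRoot.pow_eq_one
    simp only [List.mem_cons, List.not_mem_nil, or_false] at hmem
    rcases hmem with rfl | rfl | rfl | rfl | rfl | rfl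
    · exact one_pow _
    · rw [pow_mul, neg_one_sq, one_pow]
    · rw [mul_comm, pow_mul, h3, one_pow]
    · rw [pow_mul, neg_sq, ← pow_mul, mul_comm, pow_mul, h3, one_pow]
    · rw [← pow_mul, show 2 * (2 * 3) = 3 * 4 by norm_num, pow_mul, h3, one_pow]
    · rw [pow_mul, neg_sq, ← pow_mul, ← pow_mul, show 2 * 2 * 3 = 3 * 4 by norm_num, pow_mul, h3,
        one_pow]
  exact Minus.exists_eq_pow_of_pow_eq_one (p := 3) h6 hq

include hζ in
/-- **Nagell's theorem** (T. Nagell 1921; proof of K. Inkeri, [BiluBugeaudMignotte2014, Theorem 6.10]):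
for a prime `q ≥ 5`, `x³ - y^q = 1` has no solution in non-zero integers — in the cyclotomic field
`K ∋ ζ₃`. [cite: BiluBugeaudMignotte2014, Theorem 6.10] -/
theorem cube_sub_pow_ne_one_aux {q : ℕ} (hq : q.Prime) (hq5 : 5 ≤ q) {x y : ℤ} (hx : x ≠ 0)
    (hy : y ≠ 0) (h : x ^ 3 - y ^ q = 1) : False := by
  classical
  haveI : Fact (Nat.Prime 3) := ⟨Nat.prime_three⟩
  haveI : IsPrincipalIdealRing (𝓞 K) := IsCyclotomicExtension.Rat.three_pid K
  have hqo : Odd q := hq.odd_of_ne_two (by omega)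
  have h3o : Odd 3 := by decide
  set η : 𝓞 K := hζ.toInteger with hη
  -- `(x - ζ) = (ζ - 1) 𝔞^q` and `𝔞 = (γ)`
  obtain ⟨𝔞, h𝔞⟩ := span_sub_zeta_pow_eq hζ hq h3o hqo hx hy h
  obtain ⟨hfac, -⟩ := h𝔞 1 (mem_Ico.mpr ⟨le_refl 1, by norm_num⟩)
  rw [pow_one] at hfac
  obtain ⟨γ, hγ⟩ := (IsPrincipalIdealRing.principal (𝔞 1)).principal
  rw [Ideal.submodule_span_eq] at hγ
  rw [hγ, Ideal.span_singleton_pow, Ideal.span_singleton_mul_span_singleton,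
    Ideal.span_singleton_eq_span_singleton] at hfac
  obtain ⟨ε, hε⟩ := hfac
  -- `x - ζ = (ζ - 1) γ^q ε = (ζ - ζ²) α^q`
  have hq6 : q.Coprime 6 := by
    rw [show (6 : ℕ) = 2 * 3 by norm_num, Nat.coprime_mul_iff_right]
    exact ⟨(Nat.coprime_primes hq Nat.prime_two).mpr (by omega),
      (Nat.coprime_primes hq Nat.prime_three).mpr (by omega)⟩
  obtain ⟨ε₁, hε₁⟩ := exists_unit_eq_pow hζ ε⁻¹ hq6
  -- the unit `-ζ²` with `ζ - 1 = (ζ - ζ²) · (-ζ²)`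
  have hηrel : η ^ 2 + η + 1 = 0 := toInteger_sq_add hζ
  have hη3 : η ^ 3 = 1 := hζ.toInteger_isPrimitiveRoot.pow_eq_one
  have hνunit : IsUnit (-η ^ 2) := ((hζ.toInteger_isPrimitiveRoot.isUnit (by norm_num)).pow 2).neg
  obtain ⟨ν₁, hν₁⟩ := exists_unit_eq_pow hζ hνunit.unit hq6
  have hν₁' : (ν₁ : 𝓞 K) ^ q = -η ^ 2 := by
    rw [← Units.val_pow_eq_pow_val, ← hν₁, IsUnit.unit_spec]
  set α : 𝓞 K := ν₁ * ε₁ * γ with hα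
  have hxα : (x : 𝓞 K) - η = (η - η ^ 2) * α ^ q := by
    have e1 : (x : 𝓞 K) - η = (η - 1) * γ ^ q * (ε₁ : 𝓞 K) ^ q := by
      have : (x : 𝓞 K) - η = ((x : 𝓞 K) - η) * ε * (ε⁻¹ : (𝓞 K)ˣ) := by
        rw [mul_assoc, Units.mul_inv, mul_one]
      rw [this, hε, hε₁, Units.val_pow_eq_pow_val]
    rw [e1, hα, mul_pow, mul_pow, hν₁']
    linear_combination (γ ^ q * (ε₁ : 𝓞 K) ^ q * (1 - η)) * hη3
  -- conjugate: `x - ζ² = -(ζ - ζ²) β^q`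
  set β : 𝓞 K := σ • α with hβ
  have hσx : σ • ((x : 𝓞 K) - η) = (x : 𝓞 K) - η ^ 2 := by
    rw [smul_sub, Minus.gal_smul_intCast, hη, smul_toInteger hζ]
  have hη4 : η ^ (2 * 2) = η := by
    rw [show 2 * 2 = 3 + 1 by norm_num, pow_add, hη3, one_mul, pow_one]
  have hxβ : (x : 𝓞 K) - η ^ 2 = -(η - η ^ 2) * β ^ q := by
    have h' : σ • ((x : 𝓞 K) - η) = σ • ((η - η ^ 2) * α ^ q) := by rw [hxα]
    rw [hσx, smul_mul', smul_sub, smul_pow', smul_pow', hη, smul_toInteger hζ, ← hη, ← hβ,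
      ← pow_mul, hη4] at h'
    rw [h']
    ring
  -- `α^q + β^q = -1`
  have hδ0 : η - η ^ 2 ≠ 0 := toInteger_sub_sq_ne_zero hζ
  have hsum : α ^ q + β ^ q = -1 := by
    have : (η - η ^ 2) * (α ^ q + β ^ q + 1) = 0 := by
      linear_combination hxβ - hxα
    rcases mul_eq_zero.mp this with h' | h'
    · exact absurd h' hδ0
    · linear_combination h'
  -- `α, β ≠ 0`
  have hα0 : α ≠ 0 := by
    intro h0
    rw [h0, zero_pow hq.ne_zero, mul_zero, sub_eq_zero] at hxα
    -- `x = ζ`, impossible: apply `σ`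
    have h' : σ • ((x : 𝓞 K)) = σ • η := by rw [hxα]
    rw [Minus.gal_smul_intCast, hη, smul_toInteger hζ, ← hη, hxα] at h'
    exact hδ0 (by rw [← h', sub_self])
  have hβ0 : β ≠ 0 := by
    intro h0
    apply hα0
    have := congrArg (fun t : 𝓞 K => σ • t) h0
    simpa only [hβ, smul_smul_eq, smul_zero] using this
  -- `T = α + β` is a `σ`-invariant divisor of `1`, hence `±1`
  have hT : IsUnit (α + β) := by
    have hdvd : α + β ∣ α ^ q + β ^ q := hqo.add_dvd_pow_add_pow α β
    rw [hsum, dvd_neg] at hdvd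
    exact isUnit_of_dvd_one hdvd
  have hTσ : σ • (α + β) = α + β := by rw [smul_add, hβ, smul_smul_eq, add_comm]
  rcases eq_one_or_eq_neg_one_of_isUnit hζ hT hTσ with hT1 | hT1
  · -- `T = 1`: `q ∣ (α+β)^q - α^q - β^q = 2`
    have hdvd : (q : 𝓞 K) ∣ 2 := by
      obtain ⟨r, hr⟩ := exists_add_pow_prime_eq hq α β
      rw [hT1, one_pow, hsum] at hr
      exact ⟨α * β * r, by linear_combination hr⟩
    -- `q ∣ 2` in `𝓞 K`: then `q ∣ 1` (as `(q, 2) = 1`), so `q` is a `σ`-invariant unit, `q = ±1`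
    have h21 : (q : 𝓞 K) ∣ 1 := by
      obtain ⟨a, b, hab⟩ := Nat.isCoprime_iff_coprime.mpr ((Nat.coprime_primes hq Nat.prime_two).mpr (by omega))
      have : (1 : 𝓞 K) = a * q + b * 2 := by exact_mod_cast hab.symm
      rw [this]
      exact dvd_add (dvd_mul_left _ _) (hdvd.mul_left _)
    have hqσ : σ • (q : 𝓞 K) = q := gal_smul_natCast _ _
    rcases eq_one_or_eq_neg_one_of_isUnit hζ (isUnit_of_dvd_one h21) hqσ with h' | h'
    · have : q = 1 := by exact_mod_cast h'
      omega
    · have h'' : ((q : ℤ) : 𝓞 K) = ((-1 : ℤ) : 𝓞 K) := by push_cast; exact h'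
      have : (q : ℤ) = -1 := Int.cast_injective h''
      omega
  · -- `T = -1`: the lemma applies to `α` (`β = -(1 + α)`)
    have hβ' : β = -(1 + α) := by linear_combination hT1
    have hkey : (1 + α) ^ q - α ^ q = 1 := by
      rw [hβ', hqo.neg_pow] at hsum
      linear_combination -hsum
    have hu := isUnit_mul_one_add hq hq5 hα0 (by rw [← neg_ne_zero, ← hβ']; exact hβ0) hkey
    -- so `α β` is a `σ`-invariant unit: `α β = ±1`, and `(x - ζ)(x - ζ²) = 3 (αβ)^q`
    have hαβ : IsUnit (α * β) := by rw [hβ', mul_neg, IsUnit.neg_iff]; exact hu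
    have hαβσ : σ • (α * β) = α * β := by rw [smul_mul', hβ, smul_smul_eq, mul_comm]
    have hprod : ((x : 𝓞 K) - η) * ((x : 𝓞 K) - η ^ 2) = 3 * (α * β) ^ q := by
      rw [hxα, hxβ, mul_pow]
      have e : (η - η ^ 2) * -(η - η ^ 2) = 3 := by
        linear_combination (2 - η) * hη3 - hηrel
      linear_combination (α ^ q * β ^ q) * e
    have hnorm : ((x : 𝓞 K) - η) * ((x : 𝓞 K) - η ^ 2) = ((x ^ 2 + x + 1 : ℤ) : 𝓞 K) := by
      push_cast
      linear_combination (-(x : 𝓞 K)) * hηrel + hη3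
    rcases eq_one_or_eq_neg_one_of_isUnit hζ hαβ hαβσ with h1 | h1
    · rw [h1, one_pow, mul_one, hnorm] at hprod
      have hx2 : x ^ 2 + x + 1 = 3 := by exact_mod_cast hprod
      have : (x - 1) * (x + 2) = 0 := by linear_combination hx2
      rcases mul_eq_zero.mp this with h2 | h2
      · -- `x = 1`, `y = 0`
        have hx1 : x = 1 := by linarith
        rw [hx1, one_pow] at h
        exact hy (pow_eq_zero_iff hq.ne_zero |>.mp (by linarith))
      · -- `x = -2`, `y^q = -9`
        have hx2' : x = -2 := by linarith
        rw [hx2'] at h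
        have hyq : y ^ q = -9 := by linarith
        have habs : |y| ^ q = 9 := by rw [← abs_pow, hyq]; norm_num
        rcases le_or_gt |y| 1 with hle | hgt
        · have h9 : |y| ^ q ≤ 1 := pow_le_one₀ (abs_nonneg y) hle
          omega
        · have h9 : (2 : ℤ) ^ q ≤ |y| ^ q := pow_le_pow_left₀ (by norm_num) (by omega) q
          have h10 : (2 : ℤ) ^ 5 ≤ 2 ^ q := pow_le_pow_right₀ (by norm_num) hq5
          omega
    · rw [h1, hqo.neg_one_pow, hnorm] at hprod
      have hx2 : x ^ 2 + x + 1 = -3 := by exact_mod_cast hprod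
      nlinarith [sq_nonneg (2 * x + 1)]

end Cyclotomic

/-- **Nagell's theorem** (1921): for a prime `q ≥ 5` the equation `x³ - y^q = 1` has no solution
in non-zero integers. [cite: BiluBugeaudMignotte2014, Theorem 6.10] -/
theorem cube_sub_pow_ne_one {q : ℕ} (hq : q.Prime) (hq5 : 5 ≤ q) {x y : ℤ} (hx : x ≠ 0)
    (hy : y ≠ 0) : x ^ 3 - y ^ q ≠ 1 := by
  intro h
  haveI : IsCyclotomicExtension {3} ℚ (CyclotomicField 3 ℚ) :=
    CyclotomicField.instIsCyclotomicExtensionSingletonNatSetOfCharZero 3 ℚ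
  haveI : NumberField (CyclotomicField 3 ℚ) := IsCyclotomicExtension.numberField {3} ℚ _
  exact cube_sub_pow_ne_one_aux (K := CyclotomicField 3 ℚ)
    (IsCyclotomicExtension.zeta_spec 3 ℚ (CyclotomicField 3 ℚ)) hq hq5 hx hy h

/-- The mirror case `q = 3` of Catalan's equation: for a prime `p ≥ 5`, `x^p - y³ = 1` has no
solution in non-zero integers (`(-y)³ - (-x)^p = 1`). [cite: BiluBugeaudMignotte2014, Theorem 6.10] -/
theorem pow_sub_cube_ne_one {p : ℕ} (hp : p.Prime) (hp5 : 5 ≤ p) {x y : ℤ} (hx : x ≠ 0)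
    (hy : y ≠ 0) : x ^ p - y ^ 3 ≠ 1 := by
  intro h
  have hpo : Odd p := hp.odd_of_ne_two (by omega)
  refine cube_sub_pow_ne_one hp hp5 (neg_ne_zero.mpr hy) (neg_ne_zero.mpr hx) ?_
  rw [hpo.neg_pow, show (-y) ^ 3 = -y ^ 3 by ring]
  linarith

/-- **[Schoof2009, Theorem IV] for the prime `3`**: if `p, q` are odd primes and `x, y` non-zero
integers with `x ^ p - y ^ q = 1`, then `p ≥ 5` and `q ≥ 5`. [cite: Schoof2009, Theorem IV (p. 4)] -/
theorem five_le {p q : ℕ} (hp : p.Prime) (hq : q.Prime) (hpo : Odd p) (hqo : Odd q) {x y : ℤ}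
    (hx : x ≠ 0) (hy : y ≠ 0) (h : x ^ p - y ^ q = 1) : 5 ≤ p ∧ 5 ≤ q := by
  have hp3 : 3 ≤ p := by
    have := hp.two_le
    rcases hpo with ⟨k, hk⟩
    omega
  have hq3 : 3 ≤ q := by
    have := hq.two_le
    rcases hqo with ⟨k, hk⟩
    omega
  have hp4 : p ≠ 4 := by rintro rfl; exact absurd hp (by decide)
  have hq4 : q ≠ 4 := by rintro rfl; exact absurd hq (by decide)
  -- `p = q = 3` is Lemma 6.1
  have hpq : ¬ (p = 3 ∧ q = 3) := by
    rintro ⟨rfl, rfl⟩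
    exact pow_sub_pow_ne_one hpo (le_refl 3) hx hy h
  constructor
  · by_contra hlt
    have hp3' : p = 3 := by omega
    subst hp3'
    have hq5 : 5 ≤ q := by
      by_contra hq5
      have : q = 3 := by omega
      exact hpq ⟨rfl, this⟩
    exact cube_sub_pow_ne_one hq hq5 hx hy h
  · by_contra hlt
    have hq3' : q = 3 := by omega
    subst hq3'
    have hp5 : 5 ≤ p := by
      by_contra hp5
      have : p = 3 := by omega
      exact hpq ⟨this, rfl⟩
    exact pow_sub_cube_ne_one hp hp5 hx hy h

end Catalan.Nagell

end Literature.NumberTheory.DiophantineGeometry
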